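import Mathlib
import Summits.ResolutionOfSingularities.ResolutionOfSingularities.Theorems.HomologicalConductorPersistenceTruncatedPrincipalCeiling
import HarnessLib

/-!
# Rung S-2 `PersistenceSurface` (stmt-ResolutionOfSingularities-19970) — the arena ENABLING FORMULA as
# an IDEAL EQUALITY `ca(k[x,y,z]/(xy − h)) = (x̄, ȳ) + ι(ca(k[z]/(h)))`, and `ca(A_r) = (x̄, ȳ, z̄^⌈r/2⌉)`

Route `ResolutionOfSingularities/HomologicalConductor`, chain W4.4b (cell res-hironaka; seat
res-L1-w44b-stub-1 gen 5, completion of the A_r ARRIVAL cell: floor p558318, ceiling p560390).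
`[OURS · L1 w44b]` replaces the role of no printed item; NOT a statement of the manuscript under review
(Hironaka 2017), nothing here is attributed to its author; folklore commutative algebra, AI-written
(weaker than expert review).

Stub-2's cA-arena sandwich (`…PersistenceArenaSandwich`, p552485) gives, for `char k ≠ 2` and
`0 ≠ h ∈ k[z₁,…,z_{n+1}]`, `ca(T_h) = ρ₀⁻¹(ca(C_h))` for `T_h = k[x,y,z]/(xy − ι h)`, `C_h = k[z]/(h)` and
the projection `ρ₀ : T_h → C_h` (`x, y ↦ 0`); and `…PersistenceArenaGeneral` (p544909) the ideal-form LOWER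
bound `((X 0, X 1) ⊔ ι((caⁿ⁺¹ C_h)⁻¹))·T_h ≤ caⁿ⁺³(T_h)`. This file computes the KERNEL of `ρ₀` and turns
the comap form into an explicit ideal:

1. `ker_aeval_proj` — the kernel of `π : k[x,y,z] → k[z]` (`x, y ↦ 0`, `zⱼ ↦ zⱼ`) is `(X 0, X 1)`
   (every `g` has `g − ι(π g) ∈ (X 0, X 1)`, induction on `g`);
2. `ker_proj` — `ker ρ₀ = (x̄, ȳ)` in `T_h` (`Ideal.ker_quotient_lift`; `ι h ≡ x y`);
3. **`cohomologyAnnihilator_eq_map_sup`** — the ENABLING FORMULA as an ideal equality: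
   `ca(T_h) = ((X 0, X 1) ⊔ ι((ca C_h).comap mk))·T_h` (`char k ≠ 2`, `h ≠ 0`), i.e. stub-2's lower-bound
   ideal IS the cohomology annihilator at the `ca` level;
4. **`cohomologyAnnihilator_arena_X_pow_eq`** — `ca(k[x,y,z]/(xy − zᵐ)) = (x̄, ȳ, z̄^⌊m/2⌋)` for every `m` and
   `char k ≠ 2`; with `m = r + 1`: **`ca(A_r) = (x, y, z^⌈r/2⌉)`** (3 + `ca(k[z]/(zᵐ)) = (z̄^⌊m/2⌋)`,
   `…TruncatedPrincipalCeiling`, p560390);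
5. (appendix) `cohomologyAnnihilatorOfDegree_three_arena_X_pow_eq` — the same ideal is already `ca³`:
   the `A_r` surface is saturated at level `3`;
6. (appendix) `cohomologyAnnihilator_eq_cohomologyAnnihilatorOfDegree_of_centre` — in general, saturation of the
   centre `ca(C_h) = caⁿ⁺¹(C_h)` transfers to the arena: `ca(T_h) = caⁿ⁺³(T_h)`.

References: S. B. Iyengar, R. Takahashi, *Annihilation of cohomology and strong generation of module
categories*, IMRN 2016, arXiv:1404.1476, §2 [`IyengarTakahashi2014`]; the `A_r` value is classical
(Auslander–Reiten theory of `k[x,y,z]/(xy − z^{r+1})`: the indecomposable MCM modules are `(x, zʲ)`,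
`1 ≤ j ≤ r`) — here obtained without any classification of MCM modules over the surface.
-/

-- single-problem summit: the doubled namespace component `ResolutionOfSingularities` is forced
set_option linter.dupNamespace false

noncomputable section

open Literature.RingTheory.CohomologyAnnihilator
open Summit.ResolutionOfSingularities.ResolutionOfSingularities.Theorems.HomologicalConductor
open Summit.ResolutionOfSingularities.ResolutionOfSingularities.Theorems.HomologicalConductor.PersistenceArArrivalFloor
open Summit.ResolutionOfSingularities.ResolutionOfSingularities.Theorems.HomologicalConductor.PersistenceTruncatedPrincipalCeiling

universe u

namespace Summit.ResolutionOfSingularities.ResolutionOfSingularities.Theorems.HomologicalConductor.PersistenceArenaIdealFormula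

variable (k : Type u) [Field k] (n : ℕ)

/-! ## §1 The kernel of `π : k[x,y,z] → k[z]` -/

/-- Every `g ∈ k[x,y,z]` satisfies `g − ι(π g) ∈ (X 0, X 1)`, where `π` kills `x, y` and `ι` re-embeds `k[z]`
(induction on `g`: constants and sums are clear; `g = p · X i` uses `π(X 0) = π(X 1) = 0` and
`ι(π(X_{j+2})) = X_{j+2}`). [folklore] -/
theorem sub_inclusion_proj_mem_span (g : MvPolynomial (Fin (n + 3)) k) :
    g - (MvPolynomial.aeval fun j : Fin (n + 1) => (MvPolynomial.X j.succ.succ : MvPolynomial (Fin (n + 3)) k))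
        ((MvPolynomial.aeval (Fin.cons 0 (Fin.cons 0 fun j : Fin (n + 1) =>
          (MvPolynomial.X j : MvPolynomial (Fin (n + 1)) k)) : Fin (n + 3) → MvPolynomial (Fin (n + 1)) k)) g) ∈
      Ideal.span ({MvPolynomial.X 0, MvPolynomial.X 1} : Set (MvPolynomial (Fin (n + 3)) k)) := by
  induction g using MvPolynomial.induction_on with
  | C a =>
    rw [MvPolynomial.algHom_C, MvPolynomial.algebraMap_eq, MvPolynomial.algHom_C, MvPolynomial.algebraMap_eq,
      sub_self]
    exact Ideal.zero_mem _
  | add p q hp hq =>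
    rw [map_add, map_add, add_sub_add_comm]
    exact Ideal.add_mem _ hp hq
  | mul_X p i hp =>
    rw [map_mul, map_mul, MvPolynomial.aeval_X]
    refine Fin.cases ?_ (fun i' => ?_) i
    · -- `i = 0`
      rw [Fin.cons_zero, map_zero, mul_zero, sub_zero]
      exact Ideal.mul_mem_left _ _ (Ideal.subset_span (Set.mem_insert _ _))
    · refine Fin.cases ?_ (fun j => ?_) i'
      · -- `i = 1`
        rw [Fin.cons_succ, Fin.cons_zero, map_zero, mul_zero, sub_zero]
        exact Ideal.mul_mem_left _ _ (Ideal.subset_span (Set.mem_insert_of_mem _ rfl))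
      · -- `i = j + 2`
        rw [Fin.cons_succ, Fin.cons_succ, MvPolynomial.aeval_X, ← sub_mul]
        exact Ideal.mul_mem_right _ _ hp

/-- **`ker π = (X 0, X 1)`** for the projection `π : k[x,y,z₁,…,z_{n+1}] → k[z₁,…,z_{n+1}]`, `x, y ↦ 0`.
[folklore] -/
theorem ker_aeval_proj :
    RingHom.ker ((MvPolynomial.aeval (Fin.cons 0 (Fin.cons 0 fun j : Fin (n + 1) =>
        (MvPolynomial.X j : MvPolynomial (Fin (n + 1)) k)) : Fin (n + 3) → MvPolynomial (Fin (n + 1)) k) :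
          MvPolynomial (Fin (n + 3)) k →ₐ[k] MvPolynomial (Fin (n + 1)) k).toRingHom) =
      Ideal.span ({MvPolynomial.X 0, MvPolynomial.X 1} : Set (MvPolynomial (Fin (n + 3)) k)) := by
  refine le_antisymm (fun g hg => ?_) ?_
  · rw [RingHom.mem_ker, AlgHom.toRingHom_eq_coe, RingHom.coe_coe] at hg
    have h := sub_inclusion_proj_mem_span k n g
    rwa [hg, map_zero, sub_zero] at h
  · rw [Ideal.span_le]
    rintro g hg
    simp only [Set.mem_insert_iff, Set.mem_singleton_iff] at hg
    rw [SetLike.mem_coe, RingHom.mem_ker, AlgHom.toRingHom_eq_coe, RingHom.coe_coe]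
    rcases hg with rfl | rfl
    · rw [MvPolynomial.aeval_X, Fin.cons_zero]
    · rw [MvPolynomial.aeval_X, show (1 : Fin (n + 3)) = Fin.succ 0 from rfl, Fin.cons_succ, Fin.cons_zero]

/-! ## §2 The kernel of `ρ₀ : T_h → C_h` -/

/-- `ι h ≡ x y` in `T_h = k[x,y,z]/(xy − ι h)`: `mk (ι h) ∈ (x̄, ȳ)`. [folklore] -/
theorem mk_inclusion_h_mem_span (h : MvPolynomial (Fin (n + 1)) k) :
    Ideal.Quotient.mk (Ideal.span {MvPolynomial.X 0 * MvPolynomial.X 1 -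
        (MvPolynomial.aeval fun j : Fin (n + 1) => (MvPolynomial.X j.succ.succ : MvPolynomial (Fin (n + 3)) k)) h})
        ((MvPolynomial.aeval fun j : Fin (n + 1) => (MvPolynomial.X j.succ.succ : MvPolynomial (Fin (n + 3)) k)) h) ∈
      Ideal.span {Ideal.Quotient.mk (Ideal.span {MvPolynomial.X 0 * MvPolynomial.X 1 -
          (MvPolynomial.aeval fun j : Fin (n + 1) => (MvPolynomial.X j.succ.succ : MvPolynomial (Fin (n + 3)) k)) h})
          (MvPolynomial.X 0),
        Ideal.Quotient.mk (Ideal.span {MvPolynomial.X 0 * MvPolynomial.X 1 -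
          (MvPolynomial.aeval fun j : Fin (n + 1) => (MvPolynomial.X j.succ.succ : MvPolynomial (Fin (n + 3)) k)) h})
          (MvPolynomial.X 1)} := by
  have heq : Ideal.Quotient.mk (Ideal.span {MvPolynomial.X 0 * MvPolynomial.X 1 -
        (MvPolynomial.aeval fun j : Fin (n + 1) => (MvPolynomial.X j.succ.succ : MvPolynomial (Fin (n + 3)) k)) h})
        ((MvPolynomial.aeval fun j : Fin (n + 1) => (MvPolynomial.X j.succ.succ : MvPolynomial (Fin (n + 3)) k)) h) =
      Ideal.Quotient.mk _ (MvPolynomial.X 0) * Ideal.Quotient.mk _ (MvPolynomial.X 1) := by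
    rw [← map_mul, eq_comm, Ideal.Quotient.eq, Ideal.mem_span_singleton]
  rw [heq]
  exact Ideal.mul_mem_left _ _ (Ideal.subset_span (Set.mem_insert_of_mem _ rfl))

/-- **`ker ρ₀ = (x̄, ȳ)`** for the projection `ρ₀ : k[x,y,z]/(xy − ι h) → k[z]/(h)` of `…ArenaSandwich`
(`Ideal.ker_quotient_lift`: `ker ρ₀` is the image of `ker(mk ∘ π) = π⁻¹((h)) = (ι h) + ker π = (ι h, X 0, X 1)`,
and `ι h ≡ x y ∈ (x̄, ȳ)`). [folklore] -/
theorem ker_proj (h : MvPolynomial (Fin (n + 1)) k) :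
    RingHom.ker (Ideal.Quotient.lift _ _ (ArenaSandwich.mk_aeval_proj_eq_zero_of_mem k n h)) =
      Ideal.span {Ideal.Quotient.mk (Ideal.span {MvPolynomial.X 0 * MvPolynomial.X 1 -
          (MvPolynomial.aeval fun j : Fin (n + 1) => (MvPolynomial.X j.succ.succ : MvPolynomial (Fin (n + 3)) k)) h})
          (MvPolynomial.X 0),
        Ideal.Quotient.mk (Ideal.span {MvPolynomial.X 0 * MvPolynomial.X 1 -
          (MvPolynomial.aeval fun j : Fin (n + 1) => (MvPolynomial.X j.succ.succ : MvPolynomial (Fin (n + 3)) k)) h})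
          (MvPolynomial.X 1)} := by
  -- `(h) = π((ι h))`
  have hspan : Ideal.span {h} = (Ideal.span {(MvPolynomial.aeval fun j : Fin (n + 1) =>
      (MvPolynomial.X j.succ.succ : MvPolynomial (Fin (n + 3)) k)) h}).map
      ((MvPolynomial.aeval (Fin.cons 0 (Fin.cons 0 fun j : Fin (n + 1) =>
        (MvPolynomial.X j : MvPolynomial (Fin (n + 1)) k)) : Fin (n + 3) → MvPolynomial (Fin (n + 1)) k) :
          MvPolynomial (Fin (n + 3)) k →ₐ[k] MvPolynomial (Fin (n + 1)) k).toRingHom) := by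
    rw [Ideal.map_span, Set.image_singleton, AlgHom.toRingHom_eq_coe, RingHom.coe_coe,
      ArenaSandwich.aeval_proj_inclusion]
  have hsurj : Function.Surjective ((MvPolynomial.aeval (Fin.cons 0 (Fin.cons 0 fun j : Fin (n + 1) =>
        (MvPolynomial.X j : MvPolynomial (Fin (n + 1)) k)) : Fin (n + 3) → MvPolynomial (Fin (n + 1)) k) :
          MvPolynomial (Fin (n + 3)) k →ₐ[k] MvPolynomial (Fin (n + 1)) k).toRingHom) := fun s =>
    ⟨(MvPolynomial.aeval fun j : Fin (n + 1) => (MvPolynomial.X j.succ.succ : MvPolynomial (Fin (n + 3)) k)) s,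
      by rw [AlgHom.toRingHom_eq_coe, RingHom.coe_coe, ArenaSandwich.aeval_proj_inclusion]⟩
  rw [Ideal.ker_quotient_lift, ← RingHom.comap_ker, Ideal.mk_ker, hspan, Ideal.comap_map_of_surjective _ hsurj,
    ← RingHom.ker_eq_comap_bot, ker_aeval_proj, Ideal.map_sup, Ideal.map_span, Set.image_singleton,
    Ideal.map_span, Set.image_insert_eq, Set.image_singleton, sup_eq_right]
  rw [Ideal.span_le, Set.singleton_subset_iff]
  exact mk_inclusion_h_mem_span k n h

/-! ## §3 The enabling formula as an ideal equality -/

/-- **THE ENABLING FORMULA (ideal form).** For `char k ≠ 2` and `0 ≠ h ∈ k[z₁,…,z_{n+1}]`: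
`ca(k[x,y,z]/(xy − ι h)) = ((X 0, X 1) ⊔ ι((ca(k[z]/(h))).comap mk))·T_h` — the comap form
`ca(T_h) = ρ₀⁻¹(ca(C_h))` of `ArenaSandwich.cohomologyAnnihilator_eq_comap_proj` (stub-2, p552485) made
explicit by `ker ρ₀ = (x̄, ȳ)` (`ker_proj`) and `Ideal.comap_map_of_surjective`; equivalently, stub-2's
lower-bound ideal of `ArenaGeneral.map_le_cohomologyAnnihilatorOfDegree` IS the cohomology annihilator
at the `ca` level. [cite: IyengarTakahashi2014, Definition 2.1] -/
theorem cohomologyAnnihilator_eq_map_sup (h2 : (2 : k) ≠ 0) (h : MvPolynomial (Fin (n + 1)) k) (hh : h ≠ 0) :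
    cohomologyAnnihilator (MvPolynomial (Fin (n + 3)) k ⧸ Ideal.span {MvPolynomial.X 0 * MvPolynomial.X 1 -
        (MvPolynomial.aeval fun j : Fin (n + 1) => (MvPolynomial.X j.succ.succ : MvPolynomial (Fin (n + 3)) k)) h}) =
      (Ideal.span ({MvPolynomial.X 0, MvPolynomial.X 1} : Set (MvPolynomial (Fin (n + 3)) k)) ⊔
        ((cohomologyAnnihilator (MvPolynomial (Fin (n + 1)) k ⧸ Ideal.span {h})).comap
            (Ideal.Quotient.mk (Ideal.span {h}))).map
          (MvPolynomial.aeval fun j : Fin (n + 1) =>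
            (MvPolynomial.X j.succ.succ : MvPolynomial (Fin (n + 3)) k)).toRingHom).map
        (Ideal.Quotient.mk (Ideal.span {MvPolynomial.X 0 * MvPolynomial.X 1 -
          (MvPolynomial.aeval fun j : Fin (n + 1) => (MvPolynomial.X j.succ.succ : MvPolynomial (Fin (n + 3)) k)) h})) := by
  -- notation-free abbreviations via `set`
  set T := MvPolynomial (Fin (n + 3)) k ⧸ Ideal.span {MvPolynomial.X 0 * MvPolynomial.X 1 -
      (MvPolynomial.aeval fun j : Fin (n + 1) => (MvPolynomial.X j.succ.succ : MvPolynomial (Fin (n + 3)) k)) h}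
    with hT
  set ρ : T →+* MvPolynomial (Fin (n + 1)) k ⧸ Ideal.span {h} :=
    Ideal.Quotient.lift _ _ (ArenaSandwich.mk_aeval_proj_eq_zero_of_mem k n h) with hρ
  set J := (cohomologyAnnihilator (MvPolynomial (Fin (n + 1)) k ⧸ Ideal.span {h})).comap
      (Ideal.Quotient.mk (Ideal.span {h})) with hJ
  -- `ρ ∘ mk_T ∘ ι = mk_C`
  have hcomp : (ρ.comp (Ideal.Quotient.mk (Ideal.span {MvPolynomial.X 0 * MvPolynomial.X 1 -
      (MvPolynomial.aeval fun j : Fin (n + 1) => (MvPolynomial.X j.succ.succ : MvPolynomial (Fin (n + 3)) k)) h}))).comp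
        (MvPolynomial.aeval fun j : Fin (n + 1) =>
          (MvPolynomial.X j.succ.succ : MvPolynomial (Fin (n + 3)) k)).toRingHom =
      Ideal.Quotient.mk (Ideal.span {h}) := by
    refine RingHom.ext fun s => ?_
    rw [RingHom.comp_apply, RingHom.comp_apply, AlgHom.toRingHom_eq_coe, RingHom.coe_coe, hρ,
      ArenaSandwich.proj_mk_inclusion]
  -- `ca(C_h) = ρ((J·ι)·T)`
  have hca : cohomologyAnnihilator (MvPolynomial (Fin (n + 1)) k ⧸ Ideal.span {h}) =
      ((J.map (MvPolynomial.aeval fun j : Fin (n + 1) =>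
          (MvPolynomial.X j.succ.succ : MvPolynomial (Fin (n + 3)) k)).toRingHom).map
        (Ideal.Quotient.mk (Ideal.span {MvPolynomial.X 0 * MvPolynomial.X 1 -
          (MvPolynomial.aeval fun j : Fin (n + 1) =>
            (MvPolynomial.X j.succ.succ : MvPolynomial (Fin (n + 3)) k)) h}))).map ρ := by
    rw [Ideal.map_map, Ideal.map_map, hcomp, hJ, Ideal.map_comap_of_surjective _ Ideal.Quotient.mk_surjective]
  have hsurjC : Function.Surjective ((Ideal.Quotient.mk (Ideal.span {h})).comp
      (MvPolynomial.aeval (Fin.cons 0 (Fin.cons 0 fun j : Fin (n + 1) =>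
        (MvPolynomial.X j : MvPolynomial (Fin (n + 1)) k)) : Fin (n + 3) → MvPolynomial (Fin (n + 1)) k) :
          MvPolynomial (Fin (n + 3)) k →ₐ[k] MvPolynomial (Fin (n + 1)) k).toRingHom) := fun c => by
    obtain ⟨s, rfl⟩ := Ideal.Quotient.mk_surjective c
    exact ⟨(MvPolynomial.aeval fun j : Fin (n + 1) => (MvPolynomial.X j.succ.succ : MvPolynomial (Fin (n + 3)) k)) s,
      by rw [RingHom.comp_apply, AlgHom.toRingHom_eq_coe, RingHom.coe_coe, ArenaSandwich.aeval_proj_inclusion]⟩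
  have hsurjρ : Function.Surjective ρ := by
    rw [hρ]
    exact Ideal.Quotient.lift_surjective_of_surjective _ _ hsurjC
  rw [ArenaSandwich.cohomologyAnnihilator_eq_comap_proj k n h2 h hh, ← hρ, hca,
    Ideal.comap_map_of_surjective ρ hsurjρ, ← RingHom.ker_eq_comap_bot, hρ, ker_proj, Ideal.map_sup,
    Ideal.map_span _ ({MvPolynomial.X 0, MvPolynomial.X 1} : Set (MvPolynomial (Fin (n + 3)) k)),
    Set.image_insert_eq, Set.image_singleton, sup_comm]

/-! ## §4 `ca(A_r) = (x, y, z^⌈r/2⌉)` -/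

/-- `ca(k[z]/(zᵐ))` pulled back to `k[z]` is `(z^⌊m/2⌋)` (`m/2 ≤ m`). [folklore] -/
theorem comap_cohomologyAnnihilator_truncated_eq (m : ℕ) :
    (cohomologyAnnihilator (MvPolynomial (Fin 1) k ⧸ Ideal.span {(MvPolynomial.X 0 : MvPolynomial (Fin 1) k) ^ m})).comap
        (Ideal.Quotient.mk (Ideal.span {(MvPolynomial.X 0 : MvPolynomial (Fin 1) k) ^ m})) =
      Ideal.span {(MvPolynomial.X 0 : MvPolynomial (Fin 1) k) ^ (m / 2)} := by
  -- transport `ca(k[X]/(Xᵐ)) = (X̄^⌊m/2⌋)` to the `MvPolynomial (Fin 1)` presentation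
  have hca : cohomologyAnnihilator (MvPolynomial (Fin 1) k ⧸
      Ideal.span {(MvPolynomial.X 0 : MvPolynomial (Fin 1) k) ^ m}) =
      Ideal.span {(Ideal.Quotient.mk (Ideal.span {(MvPolynomial.X 0 : MvPolynomial (Fin 1) k) ^ m})
        (MvPolynomial.X 0)) ^ (m / 2)} := by
    let e := Ideal.quotientEquiv (Ideal.span {(Polynomial.X : Polynomial k) ^ m})
      (Ideal.span {(MvPolynomial.X 0 : MvPolynomial (Fin 1) k) ^ m})
      (MvPolynomial.uniqueAlgEquiv k (Fin 1)).symm.toRingEquiv (span_X_pow_eq_map k m)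
    have h := congrArg (Ideal.map (e : Polynomial k ⧸ Ideal.span {(Polynomial.X : Polynomial k) ^ m} →+*
      MvPolynomial (Fin 1) k ⧸ Ideal.span {(MvPolynomial.X 0 : MvPolynomial (Fin 1) k) ^ m}))
      (cohomologyAnnihilator_truncatedPolynomial_eq k m)
    rw [map_ringEquiv_cohomologyAnnihilator, Ideal.map_span, Set.image_singleton] at h
    rw [h, RingHom.coe_coe, map_pow, Ideal.quotientEquiv_mk, AlgEquiv.coe_ringEquiv, uniqueAlgEquiv_symm_X]
  have hmap : Ideal.span {Ideal.Quotient.mk (Ideal.span {(MvPolynomial.X 0 : MvPolynomial (Fin 1) k) ^ m})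
      ((MvPolynomial.X 0 : MvPolynomial (Fin 1) k) ^ (m / 2))} =
      (Ideal.span {(MvPolynomial.X 0 : MvPolynomial (Fin 1) k) ^ (m / 2)}).map
        (Ideal.Quotient.mk (Ideal.span {(MvPolynomial.X 0 : MvPolynomial (Fin 1) k) ^ m})) := by
    rw [Ideal.map_span, Set.image_singleton]
  rw [hca, ← map_pow, hmap, Ideal.comap_map_of_surjective _ Ideal.Quotient.mk_surjective,
    ← RingHom.ker_eq_comap_bot, Ideal.mk_ker, span_pow_sup_span_pow_eq, min_eq_left (Nat.div_le_self m 2)]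

/-- **`ca(k[x,y,z]/(xy − zᵐ)) = (x̄, ȳ, z̄^⌊m/2⌋)`** for every `m` and every field with `char k ≠ 2`; with
`m = r + 1`: **`ca(A_r) = (x, y, z^⌈r/2⌉)`** — the enabling formula `cohomologyAnnihilator_eq_map_sup` at
`n = 0`, `h = zᵐ`, with `ca(k[z]/(zᵐ)) = (z̄^⌊m/2⌋)` (`…TruncatedPrincipalCeiling`, p560390). No
classification of MCM modules over the surface is used. [cite: IyengarTakahashi2014, Definition 2.1] -/
theorem cohomologyAnnihilator_arena_X_pow_eq (h2 : (2 : k) ≠ 0) (m : ℕ) :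
    cohomologyAnnihilator (MvPolynomial (Fin 3) k ⧸
        Ideal.span {(MvPolynomial.X 0 * MvPolynomial.X 1 - MvPolynomial.X 2 ^ m : MvPolynomial (Fin 3) k)}) =
      Ideal.span {Ideal.Quotient.mk (Ideal.span {(MvPolynomial.X 0 * MvPolynomial.X 1 - MvPolynomial.X 2 ^ m :
            MvPolynomial (Fin 3) k)}) (MvPolynomial.X 0),
        Ideal.Quotient.mk (Ideal.span {(MvPolynomial.X 0 * MvPolynomial.X 1 - MvPolynomial.X 2 ^ m :
            MvPolynomial (Fin 3) k)}) (MvPolynomial.X 1),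
        Ideal.Quotient.mk (Ideal.span {(MvPolynomial.X 0 * MvPolynomial.X 1 - MvPolynomial.X 2 ^ m :
            MvPolynomial (Fin 3) k)}) (MvPolynomial.X 2) ^ (m / 2)} := by
  have hh : ((MvPolynomial.X 0 : MvPolynomial (Fin 1) k) ^ m) ≠ 0 := pow_ne_zero _ (MvPolynomial.X_ne_zero _)
  -- the formula in the `aeval` presentation, generator by generator
  have h0 := cohomologyAnnihilator_eq_map_sup k 0 h2 _ hh
  rw [comap_cohomologyAnnihilator_truncated_eq,
    Ideal.map_span _ ({(MvPolynomial.X 0 : MvPolynomial (Fin 1) k) ^ (m / 2)} : Set (MvPolynomial (Fin 1) k)),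
    Set.image_singleton, AlgHom.toRingHom_eq_coe, RingHom.coe_coe, aeval_inclusion_X_pow k (m / 2),
    aeval_inclusion_X_pow k m, ← Ideal.span_union, Set.union_singleton, Ideal.map_span, Set.image_insert_eq,
    Set.image_insert_eq, Set.image_singleton, map_pow, Set.insert_comm, Set.pair_comm] at h0
  -- `h0` now lives in the presentation `(X 0 · X 1 − X 2 ^ m)` (`Fin (0 + 3) = Fin 3` definitionally)
  exact h0


/-! ## §5 (appendix) Saturation at level 3: `ca³(A_r) = ca(A_r)` -/

/-- **`ca³(k[x,y,z]/(xy − zᵐ)) = (x̄, ȳ, z̄^⌊m/2⌋) = ca(k[x,y,z]/(xy − zᵐ))`** (`char k ≠ 2`): the `A_r` surface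
is SATURATED AT LEVEL `3 = dim + 1` (compare `ca = ca⁴ ≠ ca³` at `⅛(1,5)`, chain W4.4b S-2 census). `≤`:
`ca³ ≤ ca` and `cohomologyAnnihilator_arena_X_pow_eq`; `≥`: `x̄, ȳ ∈ ca³` (stub-2's Jacobian floor
`ArenaGeneral.mk_X0_mem_cohomologyAnnihilatorOfDegree` / `…X1…` at `n = 0`) and `z̄^⌊m/2⌋ ∈ ca³`
(`ArArrivalFloor.X_two_pow_half_mem_cohomologyAnnihilatorOfDegree_three`, p558318).
[cite: IyengarTakahashi2014, Definition 2.1] -/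
theorem cohomologyAnnihilatorOfDegree_three_arena_X_pow_eq (h2 : (2 : k) ≠ 0) (m : ℕ) :
    cohomologyAnnihilatorOfDegree (MvPolynomial (Fin 3) k ⧸
        Ideal.span {(MvPolynomial.X 0 * MvPolynomial.X 1 - MvPolynomial.X 2 ^ m : MvPolynomial (Fin 3) k)}) 3 =
      Ideal.span {Ideal.Quotient.mk (Ideal.span {(MvPolynomial.X 0 * MvPolynomial.X 1 - MvPolynomial.X 2 ^ m :
            MvPolynomial (Fin 3) k)}) (MvPolynomial.X 0),
        Ideal.Quotient.mk (Ideal.span {(MvPolynomial.X 0 * MvPolynomial.X 1 - MvPolynomial.X 2 ^ m :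
            MvPolynomial (Fin 3) k)}) (MvPolynomial.X 1),
        Ideal.Quotient.mk (Ideal.span {(MvPolynomial.X 0 * MvPolynomial.X 1 - MvPolynomial.X 2 ^ m :
            MvPolynomial (Fin 3) k)}) (MvPolynomial.X 2) ^ (m / 2)} := by
  refine le_antisymm ?_ ?_
  · rw [← cohomologyAnnihilator_arena_X_pow_eq k h2 m]
    exact cohomologyAnnihilatorOfDegree_le 3
  · -- the three generators lie in `ca³`; `x̄, ȳ` via the `aeval` presentation of `…ArenaGeneral`
    have hI : Ideal.span ({MvPolynomial.X 0 * MvPolynomial.X 1 -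
        (MvPolynomial.aeval fun j : Fin (0 + 1) => (MvPolynomial.X j.succ.succ : MvPolynomial (Fin (0 + 3)) k))
          ((MvPolynomial.X 0 : MvPolynomial (Fin 1) k) ^ m)} : Set (MvPolynomial (Fin (0 + 3)) k)) =
        Ideal.span {(MvPolynomial.X 0 * MvPolynomial.X 1 - MvPolynomial.X 2 ^ m : MvPolynomial (Fin 3) k)} := by
      rw [aeval_inclusion_X_pow]
    have hx := ringEquiv_apply_mem_cohomologyAnnihilatorOfDegree (Ideal.quotEquivOfEq hI)
      (ArenaGeneral.mk_X0_mem_cohomologyAnnihilatorOfDegree k 0 ((MvPolynomial.X 0 : MvPolynomial (Fin 1) k) ^ m))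
    have hy := ringEquiv_apply_mem_cohomologyAnnihilatorOfDegree (Ideal.quotEquivOfEq hI)
      (ArenaGeneral.mk_X1_mem_cohomologyAnnihilatorOfDegree k 0 ((MvPolynomial.X 0 : MvPolynomial (Fin 1) k) ^ m))
    rw [Ideal.quotEquivOfEq_mk] at hx hy
    rw [Ideal.span_le]
    rintro t ht
    simp only [Set.mem_insert_iff, Set.mem_singleton_iff] at ht
    rcases ht with rfl | rfl | rfl
    · exact hx
    · exact hy
    · rw [SetLike.mem_coe, ← map_pow]
      exact X_two_pow_half_mem_cohomologyAnnihilatorOfDegree_three k m h2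

/-- `ca(k[x,y,z]/(xy − zᵐ)) = ca³(k[x,y,z]/(xy − zᵐ))` (`char k ≠ 2`): saturation of the `A_r` surface at level 3.
[cite: IyengarTakahashi2014, Definition 2.1] -/
theorem cohomologyAnnihilator_arena_X_pow_eq_cohomologyAnnihilatorOfDegree_three (h2 : (2 : k) ≠ 0) (m : ℕ) :
    cohomologyAnnihilator (MvPolynomial (Fin 3) k ⧸
        Ideal.span {(MvPolynomial.X 0 * MvPolynomial.X 1 - MvPolynomial.X 2 ^ m : MvPolynomial (Fin 3) k)}) =
      cohomologyAnnihilatorOfDegree (MvPolynomial (Fin 3) k ⧸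
        Ideal.span {(MvPolynomial.X 0 * MvPolynomial.X 1 - MvPolynomial.X 2 ^ m : MvPolynomial (Fin 3) k)}) 3 := by
  rw [cohomologyAnnihilatorOfDegree_three_arena_X_pow_eq k h2 m, cohomologyAnnihilator_arena_X_pow_eq k h2 m]


/-! ## §6 (appendix) Saturation transfers along the sandwich: `ca(C_h) = caⁿ⁺¹(C_h) ⇒ ca(T_h) = caⁿ⁺³(T_h)` -/

/-- **Saturation of the centre transfers to the arena.** For `char k ≠ 2`, `0 ≠ h ∈ k[z₁,…,z_{n+1}]`: if the
hypersurface centre `C_h = k[z]/(h)` is saturated at level `n + 1 = dim C_h + 1` (`ca(C_h) = caⁿ⁺¹(C_h)`), then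
the arena `T_h = k[x,y,z]/(xy − ι h)` is saturated at level `n + 3 = dim T_h + 1`: `ca(T_h) = caⁿ⁺³(T_h)`.
`≤`: the ideal form `cohomologyAnnihilator_eq_map_sup` of `ca(T_h)`, with `ca(C_h)` replaced by `caⁿ⁺¹(C_h)`, is
stub-2's lower-bound ideal of `ArenaGeneral.map_le_cohomologyAnnihilatorOfDegree` (p544909); `≥`: `caⁿ⁺³ ≤ ca`.
Instance: `A_r` (`n = 0`, `ca(k[z]/(zᵐ)) = ca¹`, §5). [cite: IyengarTakahashi2014, Definition 2.1] -/
theorem cohomologyAnnihilator_eq_cohomologyAnnihilatorOfDegree_of_centre (h2 : (2 : k) ≠ 0)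
    (h : MvPolynomial (Fin (n + 1)) k) (hh : h ≠ 0)
    (hsat : cohomologyAnnihilator (MvPolynomial (Fin (n + 1)) k ⧸ Ideal.span {h}) =
      cohomologyAnnihilatorOfDegree (MvPolynomial (Fin (n + 1)) k ⧸ Ideal.span {h}) (n + 1)) :
    cohomologyAnnihilator (MvPolynomial (Fin (n + 3)) k ⧸ Ideal.span {MvPolynomial.X 0 * MvPolynomial.X 1 -
        (MvPolynomial.aeval fun j : Fin (n + 1) => (MvPolynomial.X j.succ.succ : MvPolynomial (Fin (n + 3)) k)) h}) =
      cohomologyAnnihilatorOfDegree (MvPolynomial (Fin (n + 3)) k ⧸ Ideal.span {MvPolynomial.X 0 * MvPolynomial.X 1 -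
        (MvPolynomial.aeval fun j : Fin (n + 1) => (MvPolynomial.X j.succ.succ : MvPolynomial (Fin (n + 3)) k)) h})
        (n + 3) := by
  refine le_antisymm ?_ (cohomologyAnnihilatorOfDegree_le (n + 3))
  rw [cohomologyAnnihilator_eq_map_sup k n h2 h hh, hsat]
  exact ArenaGeneral.map_le_cohomologyAnnihilatorOfDegree k n h2 h hh

end Summit.ResolutionOfSingularities.ResolutionOfSingularities.Theorems.HomologicalConductor.PersistenceArenaIdealFormula

end
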